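import Summits.Ventures.LatticeQCDFlow.Scaling.TaggedStartContentDeficitGlobal
import Summits.Ventures.LatticeQCDFlow.Scaling.TaggedStartContentAboveGlobal
import Summits.Ventures.LatticeQCDFlow.Scaling.TaggedStartContentDeficitSharp
import Summits.Ventures.LatticeQCDFlow.Scaling.ResolventLaw

/-!
HONEST FRAMING: exact (Metropolis-corrected) sampling algorithms for lattice gauge theory; figures
of merit are autocorrelation/cost numbers at stated couplings and volumes; no continuum-physics
claim.

# TaggedDeficitStarCover — THE DISCOUNTED START-CONTENT DEFICIT IS AT MOST `K/(K²−1)` TIMES THE TAG'S TAIL OCCUPATION: `D_J ≤ (K/(K²−1))·x̃(★)` IN THE DEEP (GLOBAL),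
# HUB-ABOVE (GLOBAL) AND RESIDUAL CONFIGURATIONS, EVERY `K ≥ 2` (lean-2 GEN-43, ours)

Venture-side (OURS).  Cell `lqcd-flow` (pub-lqcd), unit `pub-lqcd-lean-2-g43`, 2026-08-31.  Chapter AC, file 11 — the second per-edge input of the C2 ∕ C4 assembly (memo
MEMO-gen43 §3 (f)(i)).  The per-attempt bracket (file 10) charges the growth pairs of the optimal coupling one unit of potential per unit mass, so the σ-summed mean condition needs,
besides Conjecture W′ (file 3), `m·(x̃(★) + gap_a − D) ≥ D` for the constant `c = 2K + 2 + m` of the potential — a DISCOUNTED, WEAK form of Conjecture Σ (Z12 proved the per-step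
form `(y_j(z) − x_j(z))⁺ ≤ x_j(★)` only where no present content separates the extra particles).  It follows from the typed budgets against the first step of the tail resolvent,
`x̃(★) ≥ (1−σ)·acc(z,a)/K` (`tagged_star_tail_ge`), with the uniform constant `κ = K/(K²−1) = c/(1−c²)` (`= 2/3` at `K = 2`): so `m = 2` suffices everywhere.

* §1 `deficitCover_scalar` (`γ·σq/(1−(σq)²) ≤ α/(K²−1)` for `0 ≤ γ ≤ 1/K`, `0 ≤ q ≤ α/K`), `tagged_star_tail_ge`.
* §2 **`tagged_deficit_le_star_deep`** (`W_z ≤ W_b`, `W_z < W_a`, a third particle at or above `W_z`; any contents between — chapter AB file 5's budget `(1−σ)γσq/(1−σ²q²)`),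
  **`tagged_deficit_le_star_above`** (`W_a ≤ W_z` — AB file 9's budget `(1−σ)½c(σc)²/(1−σ²c²)`, `acc(z,a) = 1`), **`tagged_deficit_le_star_residual`** (`N_C(z) = 1`, others strictly
  below, `W_z ≤ W_b` — AA file 6 (B)'s budget `(1−σ)(α/(1+α))c·σc/(1−σ²c²)`): in each, `Σ_{n<J}(1−σ)σⁿ(y_{n+1}(z) − x_{n+1}(z))⁺ ≤ (K/(K²−1))·x̃(★)` for every `J`, every `K ≥ 2`.

The two configurations through the tag position at `W_z` (hub between the extra particles, with or without a third particle at or above) are file 12; the assembly on every edge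
file 13.  TOY (`numerics43/dsigma_k2.py`, NOTHING CLAIMED): in the `K = 2` lone hub between, `max D/x̃(★) = 0.21`.  Literature grade (cell rule): OWN; nothing cited; no new bib keys.
-/

open Finset

namespace Summit.Ventures.LatticeQCDFlow.Scaling

/-! ### §1 Tools -/
section CoverTools

/-- **`γ·σq/(1−(σq)²) ≤ α/(K²−1)`** for `0 ≤ γ ≤ 1/K`, `0 ≤ q ≤ α/K`, `0 ≤ α ≤ 1`, `0 ≤ σ ≤ 1`, `K ≥ 2`. [ours] -/
theorem deficitCover_scalar {K γ q α σ : ℝ} (hK : 2 ≤ K) (hγ0 : 0 ≤ γ) (hγ : γ ≤ 1 / K) (hq0 : 0 ≤ q) (hq : q ≤ α / K) (hα0 : 0 ≤ α) (hα1 : α ≤ 1)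
    (hσ0 : 0 ≤ σ) (hσ1 : σ ≤ 1) : γ * (σ * q / (1 - (σ * q) ^ 2)) ≤ α / (K ^ 2 - 1) := by
  have hK0 : 0 < K := by linarith
  have hqK : q ≤ 1 / K := hq.trans (div_le_div_of_nonneg_right hα1 hK0.le)
  have hσq0 : 0 ≤ σ * q := mul_nonneg hσ0 hq0
  have hσq : σ * q ≤ 1 / K := by nlinarith
  have hK1 : 1 / K ≤ 1 / 2 := by rw [div_le_div_iff₀ hK0 (by norm_num)]; linarith
  have hden : 1 - (1 / K) ^ 2 ≤ 1 - (σ * q) ^ 2 := by nlinarith [pow_le_pow_left₀ hσq0 hσq 2]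
  have hden0 : 0 < 1 - (1 / K) ^ 2 := by nlinarith
  have hK2 : 0 < K ^ 2 - 1 := by nlinarith
  -- numerator `γσq ≤ (1/K)(α/K)`, denominator `≥ 1 − 1/K²`
  have hnum : γ * (σ * q) ≤ 1 / K * (α / K) := by
    have h1 : σ * q ≤ q := by nlinarith
    calc γ * (σ * q) ≤ γ * q := mul_le_mul_of_nonneg_left h1 hγ0
      _ ≤ 1 / K * (α / K) := mul_le_mul hγ (by linarith) hq0 (by positivity)
  calc γ * (σ * q / (1 - (σ * q) ^ 2)) = γ * (σ * q) / (1 - (σ * q) ^ 2) := by ring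
    _ ≤ (1 / K * (α / K)) / (1 - (1 / K) ^ 2) := by
        rw [div_le_div_iff₀ (by linarith) hden0]
        exact mul_le_mul hnum hden hden0.le (by positivity)
    _ = α / (K ^ 2 - 1) := by field_simp

variable {S : Type*} [Fintype S] [DecidableEq S]
variable {W : S → ℝ} {acc : S → S → ℝ} {K : ℕ} {NC : S → ℕ} {a : S} {PX : Option S → Option S → ℝ}

/-- **The tag's tail occupation is at least its first step:** `x̃(★) ≥ (1−σ)·acc(z,a)/K`. [ours] -/
theorem tagged_star_tail_ge (hW : ∀ v, 0 < W v) (hacc : ∀ h v, acc h v = min 1 (W h / W v)) (hK : 1 ≤ K) (hNC : ∑ v, NC v = K)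
    (hPXoff : ∀ h v, h ≠ v → PX (some h) (some v) = if NC h = 0 then 0 else (NC v : ℝ) / K * acc h v)
    (hPXin : ∀ h, PX (some h) none = if NC h = 0 then 0 else acc h a / K)
    (hPXdiag : ∀ h, PX (some h) (some h) = 1 - (∑ v ∈ univ.erase h, PX (some h) (some v) + PX (some h) none))
    (hPXout : ∀ v, PX none (some v) = (NC v : ℝ) / K * acc a v) (hPXstay : PX none none = 1 - ∑ v, PX none (some v))
    {z : S} (hz : NC z ≠ 0) {σ : ℝ} (hσ0 : 0 ≤ σ) (hσ1 : σ < 1)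
    {xt : Option S → ℝ} (hxt : ∀ t, xt t = (1 - σ) * PX (some z) t + σ * ∑ t', xt t' * PX t' t) :
    (1 - σ) * (acc z a / K) ≤ xt none := by
  have hP0 := tagged_nonneg hW hacc hPXoff hPXin hPXdiag hPXout hPXstay hK hNC
  have hP1 := tagged_rowsum (P := PX) hPXdiag hPXstay
  have hxt0 : ∀ t, 0 ≤ xt t := geomResolvent_nonneg hP0 hP1 hσ0 hσ1 (ν := fun t => PX (some z) t) (fun t => hP0 _ _) hxt
  have h := hxt none
  rw [hPXin, if_neg hz] at h
  have hrest : 0 ≤ ∑ t', xt t' * PX t' none := sum_nonneg fun t' _ => mul_nonneg (hxt0 t') (hP0 _ _)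
  have := mul_nonneg hσ0 hrest
  linarith

end CoverTools

/-! ### §2 Three configurations -/
section Cover
variable {S : Type*} [Fintype S] [DecidableEq S]
variable {W : S → ℝ} {acc : S → S → ℝ} {K : ℕ} {NC : S → ℕ} {a b : S} {PX PY : Option S → Option S → ℝ}

/-- **`D_J ≤ (K/(K²−1))·x̃(★)` IN THE DEEP CONFIGURATION** (`W_z ≤ W_b`, `W_z < W_a`, a third particle at or above `W_z`, any contents between the extra particles). [ours] -/
theorem tagged_deficit_le_star_deep (hW : ∀ v, 0 < W v) (hacc : ∀ h v, acc h v = min 1 (W h / W v)) (hK : 2 ≤ K) (hNC : ∑ v, NC v = K) (hab : W b ≤ W a)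
    (hPXoff : ∀ h v, h ≠ v → PX (some h) (some v) = if NC h = 0 then 0 else (NC v : ℝ) / K * acc h v)
    (hPXin : ∀ h, PX (some h) none = if NC h = 0 then 0 else acc h a / K)
    (hPXdiag : ∀ h, PX (some h) (some h) = 1 - (∑ v ∈ univ.erase h, PX (some h) (some v) + PX (some h) none))
    (hPXout : ∀ v, PX none (some v) = (NC v : ℝ) / K * acc a v) (hPXstay : PX none none = 1 - ∑ v, PX none (some v))
    (hPYoff : ∀ h v, h ≠ v → PY (some h) (some v) = if NC h = 0 then 0 else (NC v : ℝ) / K * acc h v)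
    (hPYin : ∀ h, PY (some h) none = if NC h = 0 then 0 else acc h b / K)
    (hPYdiag : ∀ h, PY (some h) (some h) = 1 - (∑ v ∈ univ.erase h, PY (some h) (some v) + PY (some h) none))
    (hPYout : ∀ v, PY none (some v) = (NC v : ℝ) / K * acc b v) (hPYstay : PY none none = 1 - ∑ v, PY none (some v))
    {z : S} (hz : NC z ≠ 0) (hzb : W z ≤ W b) (hza : W z < W a) (hthree : 2 ≤ NC z ∨ ∃ w, w ≠ z ∧ NC w ≠ 0 ∧ W z ≤ W w)
    {x y : ℕ → Option S → ℝ}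
    (hx0 : ∀ v, x 0 v = if v = some z then 1 else 0) (hxs : ∀ n v, x (n + 1) v = ∑ h, x n h * PX h v)
    (hy0 : ∀ v, y 0 v = if v = some z then 1 else 0) (hys : ∀ n v, y (n + 1) v = ∑ h, y n h * PY h v)
    {σ : ℝ} (hσ0 : 0 ≤ σ) (hσ1 : σ < 1) {xt : Option S → ℝ} (hxt : ∀ t, xt t = (1 - σ) * PX (some z) t + σ * ∑ t', xt t' * PX t' t) (J : ℕ) :
    ∑ n ∈ range J, (1 - σ) * σ ^ n * max 0 (y (n + 1) (some z) - x (n + 1) (some z)) ≤ (K : ℝ) / ((K : ℝ) ^ 2 - 1) * xt none := by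
  have hK1 : 1 ≤ K := by omega
  have hK0 : (0 : ℝ) < K := by exact_mod_cast (show 0 < K by omega)
  have hK2r : (2 : ℝ) ≤ K := by exact_mod_cast hK
  obtain ⟨-, hbud⟩ := tagged_startClass_deficit_global hW hacc hK hNC hab hPXoff hPXin hPXdiag hPXout hPXstay hPYoff hPYin hPYdiag hPYout hPYstay
    hz hzb hza hthree hx0 hxs hy0 hys
  have hDJ := hbud σ hσ0 hσ1.le J
  -- the kernel data at the hub
  have hγeq : PX (some z) (some z) - PY (some z) (some z) = (acc z b - acc z a) / K := costSide_gamma_eq hPXoff hPXin hPXdiag hPYoff hPYin hPYdiag hz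
  obtain ⟨hγ0, hγle⟩ := costSide_gamma_le hW hacc hab hK1 z
  have hα0 : 0 ≤ acc z a := starHub_acc_nonneg hW hacc z a
  have hα1 : acc z a ≤ 1 := by rw [hacc]; exact min_le_left _ _
  have hγK : (acc z b - acc z a) / K ≤ 1 / K := hγle.trans (div_le_div_of_nonneg_right (by linarith) hK0.le)
  have hq0 : 0 ≤ max 0 ((NC z : ℝ) / K - PX (some z) (some z)) := le_max_left _ _
  have hqle : max 0 ((NC z : ℝ) / K - PX (some z) (some z)) ≤ acc z a / K :=
    max_le (div_nonneg hα0 hK0.le) (costSide_q_le hacc hK1 hNC hPXoff hPXin hPXdiag hz)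
  have hscal := deficitCover_scalar hK2r hγ0 hγK hq0 hqle hα0 hα1 hσ0 hσ1.le (σ := σ)
  rw [← hγeq] at hscal
  have hstar := tagged_star_tail_ge hW hacc hK1 hNC hPXoff hPXin hPXdiag hPXout hPXstay hz hσ0 hσ1 hxt
  have hKK : 0 < (K : ℝ) ^ 2 - 1 := by nlinarith
  calc ∑ n ∈ range J, (1 - σ) * σ ^ n * max 0 (y (n + 1) (some z) - x (n + 1) (some z))
      ≤ (1 - σ) * ((PX (some z) (some z) - PY (some z) (some z))
          * (σ * max 0 ((NC z : ℝ) / K - PX (some z) (some z)) / (1 - (σ * max 0 ((NC z : ℝ) / K - PX (some z) (some z))) ^ 2))) := hDJ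
    _ ≤ (1 - σ) * (acc z a / ((K : ℝ) ^ 2 - 1)) := mul_le_mul_of_nonneg_left hscal (by linarith)
    _ = (K : ℝ) / ((K : ℝ) ^ 2 - 1) * ((1 - σ) * (acc z a / K)) := by field_simp
    _ ≤ (K : ℝ) / ((K : ℝ) ^ 2 - 1) * xt none := mul_le_mul_of_nonneg_left hstar (by positivity)

/-- **`D_J ≤ (K/(K²−1))·x̃(★)` FOR A HUB AT OR ABOVE `W_a`** (any contents between the extra particles). [ours] -/
theorem tagged_deficit_le_star_above (hW : ∀ v, 0 < W v) (hacc : ∀ h v, acc h v = min 1 (W h / W v)) (hK : 2 ≤ K) (hNC : ∑ v, NC v = K) (hab : W b ≤ W a)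
    (hPXoff : ∀ h v, h ≠ v → PX (some h) (some v) = if NC h = 0 then 0 else (NC v : ℝ) / K * acc h v)
    (hPXin : ∀ h, PX (some h) none = if NC h = 0 then 0 else acc h a / K)
    (hPXdiag : ∀ h, PX (some h) (some h) = 1 - (∑ v ∈ univ.erase h, PX (some h) (some v) + PX (some h) none))
    (hPXout : ∀ v, PX none (some v) = (NC v : ℝ) / K * acc a v) (hPXstay : PX none none = 1 - ∑ v, PX none (some v))
    (hPYoff : ∀ h v, h ≠ v → PY (some h) (some v) = if NC h = 0 then 0 else (NC v : ℝ) / K * acc h v)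
    (hPYin : ∀ h, PY (some h) none = if NC h = 0 then 0 else acc h b / K)
    (hPYdiag : ∀ h, PY (some h) (some h) = 1 - (∑ v ∈ univ.erase h, PY (some h) (some v) + PY (some h) none))
    (hPYout : ∀ v, PY none (some v) = (NC v : ℝ) / K * acc b v) (hPYstay : PY none none = 1 - ∑ v, PY none (some v))
    {z : S} (hz : NC z ≠ 0) (haz : W a ≤ W z)
    {x y : ℕ → Option S → ℝ}
    (hx0 : ∀ v, x 0 v = if v = some z then 1 else 0) (hxs : ∀ n v, x (n + 1) v = ∑ h, x n h * PX h v)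
    (hy0 : ∀ v, y 0 v = if v = some z then 1 else 0) (hys : ∀ n v, y (n + 1) v = ∑ h, y n h * PY h v)
    {σ : ℝ} (hσ0 : 0 ≤ σ) (hσ1 : σ < 1) {xt : Option S → ℝ} (hxt : ∀ t, xt t = (1 - σ) * PX (some z) t + σ * ∑ t', xt t' * PX t' t) (J : ℕ) :
    ∑ n ∈ range J, (1 - σ) * σ ^ n * max 0 (y (n + 1) (some z) - x (n + 1) (some z)) ≤ (K : ℝ) / ((K : ℝ) ^ 2 - 1) * xt none := by
  have hK1 : 1 ≤ K := by omega
  have hK0 : (0 : ℝ) < K := by exact_mod_cast (show 0 < K by omega)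
  have hK2r : (2 : ℝ) ≤ K := by exact_mod_cast hK
  obtain ⟨-, -, -, hbud⟩ := tagged_startClass_above_global hW hacc hK hNC hab hPXoff hPXin hPXdiag hPXout hPXstay hPYoff hPYin hPYdiag hPYout hPYstay
    hz haz hx0 hxs hy0 hys
  have hDJ := hbud σ hσ0 hσ1 J
  -- `acc(z,a) = 1`
  have hacc1 : acc z a = 1 := by rw [hacc]; exact min_eq_left ((one_le_div (hW a)).mpr haz)
  have hstar := tagged_star_tail_ge hW hacc hK1 hNC hPXoff hPXin hPXdiag hPXout hPXstay hz hσ0 hσ1 hxt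
  rw [hacc1] at hstar
  have hKK : 0 < (K : ℝ) ^ 2 - 1 := by nlinarith
  -- the scalar: `½(1/K)(σ/K)²/(1−(σ/K)²) ≤ (1/K)/(K²−1)`
  have hc : σ * (1 / (K : ℝ)) ≤ 1 / 2 := by
    have : 1 / (K : ℝ) ≤ 1 / 2 := by rw [div_le_div_iff₀ hK0 (by norm_num)]; linarith
    nlinarith
  have hc0 : 0 ≤ σ * (1 / (K : ℝ)) := by positivity
  have hcK1 : σ * (1 / (K : ℝ)) ≤ 1 / K := by
    have : σ * (1 / (K : ℝ)) ≤ 1 * (1 / K) := mul_le_mul_of_nonneg_right hσ1.le (by positivity)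
    linarith
  have hcK : 1 / (K : ℝ) ≤ 1 / 2 := by rw [div_le_div_iff₀ hK0 (by norm_num)]; linarith
  have hcK0 : 0 ≤ 1 / (K : ℝ) := by positivity
  have hden : 1 - (1 / (K : ℝ)) ^ 2 ≤ 1 - (σ * (1 / (K : ℝ))) ^ 2 := by nlinarith [pow_le_pow_left₀ hc0 hcK1 2]
  have hden1 : 0 < 1 - (1 / (K : ℝ)) ^ 2 := by nlinarith [mul_le_mul hcK hcK hcK0 (by norm_num : (0:ℝ) ≤ 1 / 2)]
  have hden0 : 0 < 1 - (σ * (1 / (K : ℝ))) ^ 2 := lt_of_lt_of_le hden1 hden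
  have hscal : (1 : ℝ) / (1 + 1) * (1 / (K : ℝ)) * ((σ * (1 / (K : ℝ))) ^ 2 / (1 - (σ * (1 / (K : ℝ))) ^ 2)) ≤ (K : ℝ) / ((K : ℝ) ^ 2 - 1) * (1 / K) := by
    -- `(σc)²/(1−(σc)²) ≤ c²/(1−c²) = 1/(K²−1)` and `½c ≤ 1`
    have h1 : (σ * (1 / (K : ℝ))) ^ 2 / (1 - (σ * (1 / (K : ℝ))) ^ 2) ≤ (1 / (K : ℝ)) ^ 2 / (1 - (1 / (K : ℝ)) ^ 2) := by
      rw [div_le_div_iff₀ hden0 hden1]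
      exact mul_le_mul (pow_le_pow_left₀ hc0 hcK1 2) hden hden1.le (by positivity)
    have e1 : (1 / (K : ℝ)) ^ 2 / (1 - (1 / (K : ℝ)) ^ 2) = 1 / ((K : ℝ) ^ 2 - 1) := by field_simp
    have e2 : (K : ℝ) / ((K : ℝ) ^ 2 - 1) * (1 / K) = 1 / ((K : ℝ) ^ 2 - 1) := by field_simp
    rw [e1] at h1
    rw [e2]
    have h2 : (1 : ℝ) / (1 + 1) * (1 / (K : ℝ)) ≤ 1 := by linarith
    have h4 : 0 ≤ 1 / ((K : ℝ) ^ 2 - 1) := by positivity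
    calc (1 : ℝ) / (1 + 1) * (1 / (K : ℝ)) * ((σ * (1 / (K : ℝ))) ^ 2 / (1 - (σ * (1 / (K : ℝ))) ^ 2))
        ≤ (1 : ℝ) / (1 + 1) * (1 / (K : ℝ)) * (1 / ((K : ℝ) ^ 2 - 1)) := mul_le_mul_of_nonneg_left h1 (by positivity)
      _ ≤ 1 * (1 / ((K : ℝ) ^ 2 - 1)) := mul_le_mul_of_nonneg_right h2 h4
      _ = 1 / ((K : ℝ) ^ 2 - 1) := one_mul _
  calc ∑ n ∈ range J, (1 - σ) * σ ^ n * max 0 (y (n + 1) (some z) - x (n + 1) (some z))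
      ≤ (1 - σ) * ((1 : ℝ) / (1 + 1) * (1 / (K : ℝ)) * ((σ * (1 / (K : ℝ))) ^ 2 / (1 - (σ * (1 / (K : ℝ))) ^ 2))) := hDJ
    _ ≤ (1 - σ) * ((K : ℝ) / ((K : ℝ) ^ 2 - 1) * (1 / K)) := mul_le_mul_of_nonneg_left hscal (by linarith)
    _ = (K : ℝ) / ((K : ℝ) ^ 2 - 1) * ((1 - σ) * (1 / K)) := by ring
    _ ≤ (K : ℝ) / ((K : ℝ) ^ 2 - 1) * xt none := mul_le_mul_of_nonneg_left hstar (by positivity)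

/-- **`D_J ≤ (K/(K²−1))·x̃(★)` FOR THE RESIDUAL PAIR** (`N_C(z) = 1`, every other present content strictly below `W_z`, `W_z ≤ W_b`, `W_z < W_a`). [ours] -/
theorem tagged_deficit_le_star_residual (hW : ∀ v, 0 < W v) (hacc : ∀ h v, acc h v = min 1 (W h / W v)) (hK : 2 ≤ K) (hNC : ∑ v, NC v = K) (hab : W b ≤ W a)
    (hPXoff : ∀ h v, h ≠ v → PX (some h) (some v) = if NC h = 0 then 0 else (NC v : ℝ) / K * acc h v)
    (hPXin : ∀ h, PX (some h) none = if NC h = 0 then 0 else acc h a / K)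
    (hPXdiag : ∀ h, PX (some h) (some h) = 1 - (∑ v ∈ univ.erase h, PX (some h) (some v) + PX (some h) none))
    (hPXout : ∀ v, PX none (some v) = (NC v : ℝ) / K * acc a v) (hPXstay : PX none none = 1 - ∑ v, PX none (some v))
    (hPYoff : ∀ h v, h ≠ v → PY (some h) (some v) = if NC h = 0 then 0 else (NC v : ℝ) / K * acc h v)
    (hPYin : ∀ h, PY (some h) none = if NC h = 0 then 0 else acc h b / K)
    (hPYdiag : ∀ h, PY (some h) (some h) = 1 - (∑ v ∈ univ.erase h, PY (some h) (some v) + PY (some h) none))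
    (hPYout : ∀ v, PY none (some v) = (NC v : ℝ) / K * acc b v) (hPYstay : PY none none = 1 - ∑ v, PY none (some v))
    {z : S} (hz1 : NC z = 1) (hzb : W z ≤ W b) (hza : W z < W a) (hbelow : ∀ w, w ≠ z → NC w ≠ 0 → W w < W z)
    {x y : ℕ → Option S → ℝ}
    (hx0 : ∀ v, x 0 v = if v = some z then 1 else 0) (hxs : ∀ n v, x (n + 1) v = ∑ h, x n h * PX h v)
    (hy0 : ∀ v, y 0 v = if v = some z then 1 else 0) (hys : ∀ n v, y (n + 1) v = ∑ h, y n h * PY h v)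
    {σ : ℝ} (hσ0 : 0 ≤ σ) (hσ1 : σ < 1) {xt : Option S → ℝ} (hxt : ∀ t, xt t = (1 - σ) * PX (some z) t + σ * ∑ t', xt t' * PX t' t) (J : ℕ) :
    ∑ n ∈ range J, (1 - σ) * σ ^ n * max 0 (y (n + 1) (some z) - x (n + 1) (some z)) ≤ (K : ℝ) / ((K : ℝ) ^ 2 - 1) * xt none := by
  have hz : NC z ≠ 0 := by rw [hz1]; exact one_ne_zero
  have hK1 : 1 ≤ K := by omega
  have hK0 : (0 : ℝ) < K := by exact_mod_cast (show 0 < K by omega)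
  have hK2r : (2 : ℝ) ≤ K := by exact_mod_cast hK
  -- no present content lies strictly between the extra particles
  have hnone : ∀ w, NC w ≠ 0 → ¬ (W b < W w ∧ W w < W a) := by
    intro w hw hbw
    by_cases hwz : w = z
    · rw [hwz] at hbw; linarith [hbw.1]
    · linarith [hbelow w hwz hw, hbw.1]
  obtain ⟨-, hB, -, -⟩ := tagged_startClass_deficit hW hacc hK hNC hab hnone hPXoff hPXin hPXdiag hPXout hPXstay hPYoff hPYin hPYdiag hPYout hPYstay hz
    (x := x) (y := y) hx0 hxs hy0 hys
  obtain ⟨-, hbud⟩ := hB hzb hza hz1 hbelow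
  have hDJ := hbud σ hσ0 hσ1 J
  -- `α = W_z/W_a = acc(z,a)`
  have hαeq : acc z a = W z / W a := by rw [hacc]; exact min_eq_right ((div_le_one (hW a)).mpr hza.le)
  have hα0 : 0 ≤ W z / W a := div_nonneg (hW z).le (hW a).le
  have hstar := tagged_star_tail_ge hW hacc hK1 hNC hPXoff hPXin hPXdiag hPXout hPXstay hz hσ0 hσ1 hxt
  rw [hαeq] at hstar
  have hKK : 0 < (K : ℝ) ^ 2 - 1 := by nlinarith
  -- the scalar: `(α/(1+α))(1/K)(σ/K)/(1−(σ/K)²) ≤ (K/(K²−1))·α/K`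
  have hc0 : 0 ≤ σ * (1 / (K : ℝ)) := by positivity
  have hc : σ * (1 / (K : ℝ)) ≤ 1 / K := by
    have : σ * (1 / (K : ℝ)) ≤ 1 * (1 / K) := mul_le_mul_of_nonneg_right hσ1.le (by positivity)
    linarith
  have hcK : 1 / (K : ℝ) ≤ 1 / 2 := by rw [div_le_div_iff₀ hK0 (by norm_num)]; linarith
  have hcK0 : 0 ≤ 1 / (K : ℝ) := by positivity
  have hden : 1 - (1 / (K : ℝ)) ^ 2 ≤ 1 - (σ * (1 / (K : ℝ))) ^ 2 := by nlinarith [pow_le_pow_left₀ hc0 hc 2]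
  have hden0 : 0 < 1 - (1 / (K : ℝ)) ^ 2 := by nlinarith [mul_le_mul hcK hcK hcK0 (by norm_num : (0:ℝ) ≤ 1 / 2)]
  have hscal : (W z / W a) / (1 + W z / W a) * (1 / (K : ℝ)) * (σ * (1 / (K : ℝ)) / (1 - (σ * (1 / (K : ℝ))) ^ 2))
      ≤ (K : ℝ) / ((K : ℝ) ^ 2 - 1) * ((W z / W a) / K) := by
    have h1 : (W z / W a) / (1 + W z / W a) ≤ W z / W a := div_le_self hα0 (by linarith)
    have h2 : σ * (1 / (K : ℝ)) / (1 - (σ * (1 / (K : ℝ))) ^ 2) ≤ (1 / (K : ℝ)) / (1 - (1 / (K : ℝ)) ^ 2) := by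
      rw [div_le_div_iff₀ (lt_of_lt_of_le hden0 hden) hden0]
      exact mul_le_mul hc hden hden0.le (by positivity)
    have hden2 : 0 < 1 - (σ * (1 / (K : ℝ))) ^ 2 := lt_of_lt_of_le hden0 hden
    have h3 : (W z / W a) / (1 + W z / W a) * (1 / (K : ℝ)) * (σ * (1 / (K : ℝ)) / (1 - (σ * (1 / (K : ℝ))) ^ 2))
        ≤ (W z / W a) * (1 / (K : ℝ)) * ((1 / (K : ℝ)) / (1 - (1 / (K : ℝ)) ^ 2)) :=
      mul_le_mul (mul_le_mul_of_nonneg_right h1 (by positivity)) h2 (div_nonneg hc0 hden2.le) (by positivity)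
    have e : (W z / W a) * (1 / (K : ℝ)) * ((1 / (K : ℝ)) / (1 - (1 / (K : ℝ)) ^ 2)) = (K : ℝ) / ((K : ℝ) ^ 2 - 1) * ((W z / W a) / K) := by
      field_simp
    linarith [h3, e.le]
  calc ∑ n ∈ range J, (1 - σ) * σ ^ n * max 0 (y (n + 1) (some z) - x (n + 1) (some z))
      ≤ (1 - σ) * ((W z / W a) / (1 + W z / W a) * (1 / (K : ℝ)) * (σ * (1 / (K : ℝ)) / (1 - (σ * (1 / (K : ℝ))) ^ 2))) := hDJ
    _ ≤ (1 - σ) * ((K : ℝ) / ((K : ℝ) ^ 2 - 1) * ((W z / W a) / K)) := mul_le_mul_of_nonneg_left hscal (by linarith)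
    _ = (K : ℝ) / ((K : ℝ) ^ 2 - 1) * ((1 - σ) * ((W z / W a) / K)) := by ring
    _ ≤ (K : ℝ) / ((K : ℝ) ^ 2 - 1) * xt none := mul_le_mul_of_nonneg_left hstar (by positivity)

end Cover

end Summit.Ventures.LatticeQCDFlow.Scaling
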